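import Mathlib.RingTheory.DiscreteValuationRing.Basic
import Mathlib.RingTheory.DedekindDomain.Basic
import Mathlib.RingTheory.FiniteLength
import Mathlib.RingTheory.LocalRing.ResidueField.Basic
import Mathlib.RingTheory.Localization.FractionRing
import Mathlib.RingTheory.Localization.Integral
import Mathlib.RingTheory.IntegralClosure.IntegrallyClosed
import Mathlib.RingTheory.TensorProduct.Free
import Mathlib.LinearAlgebra.TensorProduct.Tower
import HarnessLib

/-!
# The Deligne–Serre lifting lemma and the Krull–Akizuki theorem

Two results of commutative algebra used in the proof of the Deligne–Serre theorem on weight-one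
modular forms (Deligne–Serre 1974, Thm. 4.1, via Thm. 6.7 = reduction and lifting of systems of
Hecke eigenvalues modulo `λ`), vendored as named facts (D-0014) in the layer below
`Literature.NumberTheory.EllipticCurves.ModularForms.DeligneSerre1974.thm41_exists`
(`Literature.NumberTheory.EllipticCurves.NewformGaloisRepProofs`).

* `Literature.RingTheory.DiscreteValuationRing.KrullAkizuki` — Matsumura, *Commutative Ring Theory*, Thm. 11.7: for a one-dimensional
  Noetherian domain `A` with fraction field `K`, a finite extension `L / K` and any ring
  `A ⊆ B ⊆ L`, the ring `B` is Noetherian of dimension `≤ 1` and `B / J` has finite length over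
  `A` for every non-zero ideal `J` of `B`. (Consequence used downstream: the integral closure of
  a discrete valuation ring in a finite, possibly inseparable, extension is a Dedekind domain,
  so a discrete valuation ring extends to every finite extension of its fraction field; Mathlib's
  `IsIntegralClosure.isDedekindDomain` needs separability.)
* `Literature.RingTheory.DiscreteValuationRing.DeligneSerre1974.lemma611` — Deligne–Serre 1974, Lemme 6.11 (the "Deligne–Serre lifting
  lemma"): a system of eigenvalues of pairwise commuting endomorphisms of a finite free module
  `M` over a discrete valuation ring `𝒪`, occurring on a common eigenvector of `M / 𝔪 M`, lifts —
  after a finite extension `𝒪 ⊆ 𝒪'` of discrete valuation rings — to a system of eigenvalues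
  occurring on a common eigenvector of `𝒪' ⊗ M` ("on n'affirme pas que les vecteurs propres se
  relèvent, mais seulement les valeurs propres").

## Design notes

* `M / 𝔪 M` is written `k ⊗[𝒪] M` with `k = IsLocalRing.ResidueField 𝒪`, an endomorphism `T`
  acting by `T.baseChange k`; likewise `M' = 𝒪' ⊗[𝒪] M` with `T.baseChange 𝒪'`. The eigenvalue
  systems are functions `Module.End 𝒪 M → k` (resp. `→ 𝒪'`) whose values off `𝒯` are irrelevant.
* "`𝒪'` contenant `𝒪`, d'idéal maximal `𝔪'` tel que `𝒪 ∩ 𝔪' = 𝔪`, et de corps des fractions `K'`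
  fini sur `K`": `K'` is a field, finite-dimensional over `K = FractionRing 𝒪` and an
  `𝒪`-algebra through `K` (so `𝒪 → K'` is injective); `𝒪'` is a discrete valuation ring with an
  `𝒪`-algebra structure and fraction field `K'`, compatibly (`IsScalarTower 𝒪 𝒪' K'`, whence
  `𝒪 → 𝒪'` is injective: "contenant `𝒪`"), and `𝔪'.comap (algebraMap 𝒪 𝒪') = 𝔪`.
  The congruence `a'_T ≡ a_T (mod 𝔪')` is stated lift-wise: for every `s : 𝒪` with residue
  `a_T`, `a'_T − s ∈ 𝔪'` (equivalent, `residue` being surjective; avoids threading an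
  `IsLocalHom` instance through `ResidueField.map`).
* "one-dimensional Noetherian domain" = `IsNoetherianRing A`, `Ring.DimensionLEOne A` and
  `¬ IsField A` (Krull dimension exactly `1`), as printed.
* Universes: `𝒪` and `M` are taken in one universe `u` (no loss: `M ≅ 𝒪ⁿ`), and the extension
  `K'`, `𝒪'` is produced in the same universe (in the printed proof it is built from quotients
  and localisations of the finite `𝒪`-algebra `𝒪[𝒯] ⊆ End_𝒪(M)`).
* Mathlib has neither result (searched `KrullAkizuki`, `Akizuki`, `DimensionLEOne` +
  `IsNoetherianRing` consequences, `integralClosure.isDedekindDomain` — separable only).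

## References

* P. Deligne, J.-P. Serre, *Formes modulaires de poids 1*, Ann. Sci. ÉNS (4) 7 (1974), 507–530,
  Lemme 6.11 (p. 522).
* H. Matsumura, *Commutative Ring Theory*, Cambridge Studies in Advanced Mathematics 8 (1986),
  Thm. 11.7 (Krull–Akizuki), p. 84.
-/

universe u v w

open scoped TensorProduct

open IsLocalRing

namespace Literature.RingTheory.DiscreteValuationRing

/-- **Krull–Akizuki theorem** (Matsumura, *Commutative Ring Theory*, Thm. 11.7). Let `A` be a
one-dimensional Noetherian integral domain with field of fractions `K`, let `L` be a finite
(algebraic) extension field of `K`, and `B` a ring with `A ⊆ B ⊆ L`. Then `B` is a Noetherian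
ring of dimension at most `1`, and if `J` is a non-zero ideal of `B` then `B / J` is an
`A`-module of finite length. [cite: Matsumura1987, Thm. 11.7] -/
def KrullAkizuki : Prop :=
  ∀ ⦃A : Type u⦄ [CommRing A] [IsDomain A] [IsNoetherianRing A] [Ring.DimensionLEOne A],
    ¬ IsField A →
  ∀ ⦃K : Type v⦄ [Field K] [Algebra A K] [IsFractionRing A K]
    ⦃L : Type w⦄ [Field L] [Algebra K L] [FiniteDimensional K L] [Algebra A L]
    [IsScalarTower A K L] (B : Subalgebra A L),
    IsNoetherianRing B ∧ Ring.DimensionLEOne B ∧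
      ∀ J : Ideal B, J ≠ ⊥ → IsFiniteLength A (B ⧸ J)

/-- **Corollary of Krull–Akizuki** (Matsumura, *Commutative Ring Theory*, Cor. to Thm. 11.7):
for a one-dimensional Noetherian domain `A` with fraction field `K` and a finite extension
`L / K` (no separability assumed), the integral closure `B` of `A` in `L` is a Dedekind domain —
by the theorem `B` is Noetherian of dimension `≤ 1`, and it is normal by construction (its
fraction field is `L`, Mathlib `integralClosure.isFractionRing_of_finite_extension`).
[cite: Matsumura1987, Cor. to Thm. 11.7] -/
theorem KrullAkizuki.isDedekindDomain_integralClosure (h : KrullAkizuki.{u, v, w})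
    {A : Type u} [CommRing A] [IsDomain A] [IsNoetherianRing A] [Ring.DimensionLEOne A]
    (hA : ¬ IsField A) (K : Type v) [Field K] [Algebra A K] [IsFractionRing A K]
    (L : Type w) [Field L] [Algebra K L] [FiniteDimensional K L] [Algebra A L]
    [IsScalarTower A K L] : IsDedekindDomain (integralClosure A L) := by
  obtain ⟨hN, hD, -⟩ := h hA (K := K) (integralClosure A L)
  haveI : IsFractionRing (integralClosure A L) L :=
    integralClosure.isFractionRing_of_finite_extension K L
  have hIC : IsIntegrallyClosed (integralClosure A L) :=
    (isIntegrallyClosed_iff L).mpr fun {x} hx ↦ ⟨⟨x, isIntegral_trans x hx⟩, rfl⟩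
  exact { hN, hD, hIC with }

namespace DeligneSerre1974

/-- **Deligne–Serre lifting lemma** (Deligne–Serre 1974, Lemme 6.11). Let `M` be a free module
of finite type over a discrete valuation ring `𝒪`, with maximal ideal `𝔪`, residue field `k` and
field of fractions `K`. Let `𝒯` be a set of pairwise commuting endomorphisms of `M`. Let
`f ∈ M / 𝔪 M` (`= k ⊗_𝒪 M`) be a non-zero common eigenvector of the `T ∈ 𝒯`, with eigenvalues
`a_T ∈ k`. Then there exist a discrete valuation ring `𝒪'` containing `𝒪`, with maximal ideal
`𝔪'` such that `𝒪 ∩ 𝔪' = 𝔪` and with field of fractions `K'` finite over `K`, and a non-zero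
element `f'` of `M' = 𝒪' ⊗_𝒪 M` which is an eigenvector of the `T ∈ 𝒯`, with eigenvalues
`a'_T` such that `a'_T ≡ a_T (mod 𝔪')`. (The eigenvalues lift, not necessarily the
eigenvector.) [cite: DeligneSerreASENS1974, Lemme 6.11] -/
def lemma611 : Prop :=
  ∀ ⦃𝒪 : Type u⦄ [CommRing 𝒪] [IsDomain 𝒪] [IsDiscreteValuationRing 𝒪]
    ⦃M : Type u⦄ [AddCommGroup M] [Module 𝒪 M] [Module.Free 𝒪 M] [Module.Finite 𝒪 M]
    (𝒯 : Set (Module.End 𝒪 M)), (∀ S ∈ 𝒯, ∀ T ∈ 𝒯, Commute S T) →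
  ∀ (a : Module.End 𝒪 M → ResidueField 𝒪) (f : ResidueField 𝒪 ⊗[𝒪] M), f ≠ 0 →
    (∀ T ∈ 𝒯, T.baseChange (ResidueField 𝒪) f = a T • f) →
    ∃ (K' : Type u) (_ : Field K') (_ : Algebra 𝒪 K') (_ : Algebra (FractionRing 𝒪) K')
      (_ : IsScalarTower 𝒪 (FractionRing 𝒪) K') (_ : FiniteDimensional (FractionRing 𝒪) K')
      (𝒪' : Type u) (_ : CommRing 𝒪') (_ : IsDomain 𝒪') (_ : IsDiscreteValuationRing 𝒪')
      (_ : Algebra 𝒪 𝒪') (_ : Algebra 𝒪' K') (_ : IsScalarTower 𝒪 𝒪' K')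
      (_ : IsFractionRing 𝒪' K'),
      (maximalIdeal 𝒪').comap (algebraMap 𝒪 𝒪') = maximalIdeal 𝒪 ∧
      ∃ (a' : Module.End 𝒪 M → 𝒪') (f' : 𝒪' ⊗[𝒪] M), f' ≠ 0 ∧
        (∀ T ∈ 𝒯, T.baseChange 𝒪' f' = a' T • f') ∧
        ∀ T ∈ 𝒯, ∀ s : 𝒪, residue 𝒪 s = a T → a' T - algebraMap 𝒪 𝒪' s ∈ maximalIdeal 𝒪'

end DeligneSerre1974

end Literature.RingTheory.DiscreteValuationRing
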